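import Literature.NumberTheory.EllipticCurves.BurungaleSkinner2023.RootNumberLambdaParityProofs
import Literature.NumberTheory.EllipticCurves.PAdicLFunctionMultiplicativeFunctionalEquationProofs
import Literature.NumberTheory.EllipticCurves.AtkinLehnerInvolutionsNewformProofs
import Literature.Barriers.BirchSwinnertonDyer.PAdicFunctionalEquationSharpFlatTwoProofs
import HarnessLib

/-!
# The `p`-adic functional equation in IDEAL FORM: `(L_p(E, T^ι)) = (L_p(E, T))` as principal ideals

Proofs-companion of `PAdicFunctionalEquationParity` / `PAdicFunctionalEquationParityProofs`
(theorems only, no named fact). Greenberg, LNM 1716, §1 (p. 68), states the functional equation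
`L_p(E/ℚ, 2 - s) = w_E ⟨N_E⟩^{s-1} L_p(E/ℚ, s)` of Mazur–Tate–Teitelbaum (Invent. Math. 84 (1986),
§I.17, (18.3)) and adds: "In particular, `f_E^{anal}(T^ι)/f_E^{anal}(T)` should be in `Λ^×`, where
`T^ι = (1+T)^{-1} - 1`" — i.e. the involution `ι` FIXES THE PRINCIPAL IDEAL generated by the
`p`-adic `L`-function. This file records that consequence, `Ideal.span {L(T^ι)} = Ideal.span {L}`,
for every functional equation the tree PROVES, so that consumers comparing characteristic ideals
under `ι` (the `γ ↦ γ⁻¹` / contragredient re-keys of the Iwasawa main conjecture inputs) can rewrite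
by ONE lemma instead of carrying the sign `w = ±1` and the multiplier `(1 + T)^c`:

* generic algebra (`R` any commutative ring, so `R = ℚ_p` AND `R = ℤ_p`, `Λ = ℤ_p⟦T⟧`, are covered):
  `isUnit_of_mem_principalUnits` (`u(0) = 1 ⇒ u ∈ R⟦T⟧^×`), `isUnit_binomialSeries'`
  (`(1 + T)^c ∈ R⟦T⟧^×`), `span_singleton_subst_eq_of_subst_eq` (`g(T^ι) = w·u·g`, `w, u` units `⇒ (g(T^ι)) = (g)`),
  `span_singleton_subst_eq_of_mem_padicFEClass` (the same for `g ∈ padicFEClass U w`,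
  `U ⊆ principalUnits`), `associated_subst_of_mem_padicFEClass`;
* GOOD ORDINARY `p` (any level, any prime, Mazur–Tate–Teitelbaum §I.17 as proved in
  `padicLFunction_mem_padicFEClass_neg_frickeEigenvalue`): `span_singleton_subst_padicLFunction_eq`
  — `(L_p(E, T^ι)) = (L_p(E, T))` in `ℚ_p⟦T⟧`; relative to the named fact:
  `padicLFunction_functional_equation.span_singleton_subst_eq`;
* MULTIPLICATIVE `p ∥ N` (exceptional-zero case included; MTT §I.17 with `⟨M⟩ = γ^c`, `M = N/p`, as
  proved in `IsSplitMultPAdicLFunctionOf.subst_eq_of_atkinLehner` /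
  `IsMultPAdicLFunctionOf.subst_eq_of_atkinLehner`):
  `IsSplitMultPAdicLFunctionOf.span_singleton_subst_eq`, `IsMultPAdicLFunctionOf.span_singleton_subst_eq`
  — the Atkin–Lehner sign and the exponent are produced inside (Knapp, Thm. 9.27(b);
  `exists_teichmuller_exponent_natCast`), so the only hypotheses are the reduction type, the newform
  and `N = pM`, `p ∤ M`;
* IN `Λ = ℤ_p⟦T⟧`: `IwasawaAlgebra.span_singleton_subst_eq_of_iwasawaToPowerSeries_eq` (descent of
  any `ℚ_p⟦T⟧`-functional equation to an integral lift `b`, `ι_Λ b = t · L`, after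
  Burungale–Skinner 2023, Prop. 2.2, proof — tree theorem
  `subst_invOnePlusSubOne_eq_of_iwasawaToPowerSeries_eq`), its good-ordinary instance
  `IwasawaAlgebra.span_singleton_subst_eq_of_eq_padicLFunction`, and Sprung's pair at a supersingular
  `2` with `a₂ = 0`: `span_singleton_subst_eq_of_isSprungPair_two` (from
  `exists_functionalEquation_sharp_flat_two`).

Not covered (no functional equation in the tree): Pollack's `L_p^±` at an ODD supersingular prime
(Pollack 2003, Thm. 5.13 — "not vendored", see `PlusMinusPAdicLFunction`).

## References

* R. Greenberg, *Iwasawa theory for elliptic curves*, LNM 1716 (1999), §1, pp. 67–68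
  ("`f_E^{anal}(T^ι)/f_E^{anal}(T)` should be in `Λ^×`"). [GreenbergLNM1716]
* B. Mazur, J. Tate, J. Teitelbaum, *On `p`-adic analogues of the conjectures of Birch and
  Swinnerton-Dyer*, Invent. Math. 84 (1986), §I.17–§I.18 (functional equation, (18.3)).
  [MazurTateTeitelbaum1986Invent]
* A. Burungale, C. Skinner, Proc. AMS Ser. B 10 (2023), Prop. 2.2 (descent of the functional
  equation to `Λ`). [BurungaleSkinner2023]
* F. Sprung, *The Iwasawa main conjecture for elliptic curves at odd supersingular primes …* /
  J. Number Theory (2017), Cor. 4.14 (functional equation of `L♯`, `L♭`). [Sprung2017]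
* A. W. Knapp, *Elliptic curves* (1993), Thm. 9.27(b) (Atkin–Lehner eigenvalues). [Knapp1993]
-/

noncomputable section

open scoped MatrixGroups ModularForm

open CongruenceSubgroup PowerSeries WeierstrassCurve
  Literature.NumberTheory.EllipticCurves Literature.NumberTheory.EllipticCurves.ModularForms
  Literature.NumberTheory.EllipticCurves.Sprung2017

namespace Literature.Barriers.BirchSwinnertonDyer

/-! ### Generic algebra: a functional equation with unit sign and unit multiplier fixes the ideal -/

section Generic

variable {R : Type*} [CommRing R]

/-- A power series with constant term `1` is a unit of `R⟦T⟧` (Mathlib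
`PowerSeries.isUnit_iff_constantCoeff`; private plumbing). [folklore] -/
private theorem isUnit_of_constantCoeff_eq_one {u : R⟦X⟧} (hu : constantCoeff u = 1) : IsUnit u := by
  rw [PowerSeries.isUnit_iff_constantCoeff, hu]
  exact isUnit_one

/-- Every **principal unit** `u`, `u(0) = 1`, is a unit of `R⟦T⟧` — in particular every printed
multiplier `⟨N_E⟩^{s-1} = (1 + T)^c` ("should be in `Λ^×`").
[cite: GreenbergLNM1716, §1 (p. 68: the multiplier `⟨N_E⟩^{s-1}` and `Λ^×`)] -/
theorem isUnit_of_mem_principalUnits {u : R⟦X⟧} (hu : u ∈ principalUnits R) : IsUnit u :=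
  isUnit_of_constantCoeff_eq_one hu

/-- **`(1 + T)^c` is a unit of `A⟦T⟧`** for every exponent `c` in a binomial ring `S` acting on `A`
(constant term `1`, Mathlib `binomialSeries_constantCoeff`); e.g. `S = ℤ_p`, `A = ℚ_p` or `A = ℤ_p`
(`Λ`). [cite: GreenbergLNM1716, §1 (p. 68: the multiplier `⟨N_E⟩^{s-1} = (1+T)^c ∈ Λ^×`)] -/
theorem isUnit_binomialSeries' (A : Type*) [CommRing A] {S : Type*} [CommRing S] [BinomialRing S]
    [Algebra S A] (c : S) : IsUnit (binomialSeries A c) :=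
  isUnit_of_constantCoeff_eq_one (binomialSeries_constantCoeff (A := A) c)

/-- A sign `σ = ±1` (recorded as `σ² = 1` in `ℤ`) is a unit in every ring (private plumbing).
[folklore] -/
private theorem isUnit_intCast_of_sq_eq_one {S : Type*} [Ring S] {σ : ℤ} (hσ : σ ^ 2 = 1) :
    IsUnit ((σ : ℤ) : S) :=
  have h : (σ : S) * (σ : S) = 1 := by rw [← Int.cast_mul, ← sq, hσ, Int.cast_one]
  ⟨⟨(σ : S), (σ : S), h, h⟩, rfl⟩

/-- **Ideal form of a functional equation.** If `g(ι') = w · u · g` with `w ∈ R^×` and `u ∈ R⟦T⟧^×`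
then the principal ideals of `g(ι')` and `g` coincide: `(g(ι')) = (g)`. (Greenberg: "`f(T^ι)/f(T)`
should be in `Λ^×`".) [cite: GreenbergLNM1716, §1 (p. 68)] -/
theorem span_singleton_subst_eq_of_subst_eq {g u ι' : R⟦X⟧} {w : R} (hw : IsUnit w) (hu : IsUnit u)
    (h : g.subst ι' = C w * u * g) : Ideal.span {g.subst ι'} = Ideal.span {g} := by
  rw [h]
  exact Ideal.span_singleton_mul_left_unit ((hw.map C).mul hu) g

/-- **`g(ι')` and `g` are associated** under the same hypotheses. [cite: GreenbergLNM1716, §1 (p. 68)] -/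
theorem associated_subst_of_subst_eq {g u ι' : R⟦X⟧} {w : R} (hw : IsUnit w) (hu : IsUnit u)
    (h : g.subst ι' = C w * u * g) : Associated (g.subst ι') g := by
  refine (?_ : Associated g (g.subst ι')).symm
  exact ⟨((hw.map C).mul hu).unit, by rw [IsUnit.unit_spec, mul_comm, h]⟩

/-- **Ideal form for the class `padicFEClass U w`**: for a multiplier set of principal units
(`U ⊆ {u | u(0) = 1}`, e.g. `binomialMultipliers p`) and a unit sign `w`, every member `g`
(`g(T^ι) = w·u·g`, `T^ι = invOnePlusSubOne = (1+T)⁻¹ - 1`) generates an `ι`-stable principal ideal: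
`(g(T^ι)) = (g)` in `R⟦T⟧`. [cite: GreenbergLNM1716, §1 (p. 68: "`f(T^ι)/f(T)` should be in `Λ^×`")] -/
theorem span_singleton_subst_eq_of_mem_padicFEClass {U : Set R⟦X⟧} (hU : U ⊆ principalUnits R)
    {w : R} (hw : IsUnit w) {g : R⟦X⟧} (hg : g ∈ padicFEClass U w) :
    Ideal.span {g.subst (invOnePlusSubOne : R⟦X⟧)} = Ideal.span {g} := by
  obtain ⟨u, hu, h⟩ := hg
  exact span_singleton_subst_eq_of_subst_eq hw (isUnit_of_mem_principalUnits (hU hu)) h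

/-- `g(T^ι)` and `g` are associated for `g ∈ padicFEClass U w`, `U ⊆ principalUnits`, `w` a unit.
[cite: GreenbergLNM1716, §1 (p. 68)] -/
theorem associated_subst_of_mem_padicFEClass {U : Set R⟦X⟧} (hU : U ⊆ principalUnits R)
    {w : R} (hw : IsUnit w) {g : R⟦X⟧} (hg : g ∈ padicFEClass U w) :
    Associated (g.subst (invOnePlusSubOne : R⟦X⟧)) g := by
  obtain ⟨u, hu, h⟩ := hg
  exact associated_subst_of_subst_eq hw (isUnit_of_mem_principalUnits (hU hu)) h

end Generic

/-! ### Good ordinary reduction: `(L_p(E, T^ι)) = (L_p(E, T))` in `ℚ_p⟦T⟧` -/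

section Ordinary

variable {p : ℕ} [Fact p.Prime] {W : WeierstrassCurve ℚ} [W.IsElliptic] [W.IsGloballyMinimal]
  {N : ℕ} [NeZero N] {f : CuspForm (Gamma0 N) 2}

/-- **`(L_p(E, T^ι)) = (L_p(E, T))` as ideals of `ℚ_p⟦T⟧`, good ordinary `p` (ANY prime, ANY
level).** For `W/ℚ` elliptic, globally minimal, good ordinary at `p`, `f ∈ S₂(Γ₀(N))` its newform and
`L_p(E, T) = padicLFunction f (unitRoot W p)`: the functional equation
`L_p(E, T^ι) = σ (1+T)^c L_p(E, T)`, `σ = -ε(f) = ±1` (`padicLFunction_mem_padicFEClass_neg_frickeEigenvalue`,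
Mazur–Tate–Teitelbaum §I.17) has unit sign and unit multiplier.
[cite: MazurTateTeitelbaum1986Invent, §I.17] [cite: GreenbergLNM1716, §1 (p. 68: "`f(T^ι)/f(T) ∈ Λ^×`")] -/
theorem span_singleton_subst_padicLFunction_eq (hord : IsOrdinaryAt W p) (hf : IsNewformOf W f) :
    Ideal.span {(padicLFunction f (unitRoot W p : ℚ_[p])).subst (invOnePlusSubOne : ℚ_[p]⟦X⟧)} =
      Ideal.span {padicLFunction f (unitRoot W p : ℚ_[p])} := by
  obtain ⟨σ, hσ, -, hmem⟩ := padicLFunction_mem_padicFEClass_neg_frickeEigenvalue hord hf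
  have hσ2 : σ ^ 2 = 1 := by rcases hσ with rfl | rfl <;> norm_num
  exact span_singleton_subst_eq_of_mem_padicFEClass (binomialMultipliers_subset_principalUnits p)
    (isUnit_intCast_of_sq_eq_one hσ2) hmem

/-- `L_p(E, T^ι)` and `L_p(E, T)` are associated in `ℚ_p⟦T⟧` (good ordinary `p`, any level, any
prime). [cite: MazurTateTeitelbaum1986Invent, §I.17] [cite: GreenbergLNM1716, §1 (p. 68)] -/
theorem associated_subst_padicLFunction (hord : IsOrdinaryAt W p) (hf : IsNewformOf W f) :
    Associated ((padicLFunction f (unitRoot W p : ℚ_[p])).subst (invOnePlusSubOne : ℚ_[p]⟦X⟧))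
      (padicLFunction f (unitRoot W p : ℚ_[p])) := by
  obtain ⟨σ, hσ, -, hmem⟩ := padicLFunction_mem_padicFEClass_neg_frickeEigenvalue hord hf
  have hσ2 : σ ^ 2 = 1 := by rcases hσ with rfl | rfl <;> norm_num
  exact associated_subst_of_mem_padicFEClass (binomialMultipliers_subset_principalUnits p)
    (isUnit_intCast_of_sq_eq_one hσ2) hmem

omit [W.IsElliptic] in
/-- **Ideal form relative to the named fact** `padicLFunction_functional_equation W p` (odd good
ordinary `p`, sign `w_E = W.rootNumber = ±1`): `(L_p(E, T^ι)) = (L_p(E, T))` in `ℚ_p⟦T⟧`. For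
consumers that hold the fact as a hypothesis; unconditionally see
`span_singleton_subst_padicLFunction_eq`. [cite: GreenbergLNM1716, §1 (pp. 67–68)]
[cite: MazurTateTeitelbaum1986Invent, §I.17] -/
theorem padicLFunction_functional_equation.span_singleton_subst_eq
    (hFE : padicLFunction_functional_equation W p (f := f)) (hp : p ≠ 2)
    (hord : IsOrdinaryAt W p) (hf : IsNewformOf W f) :
    Ideal.span {(padicLFunction f (unitRoot W p : ℚ_[p])).subst (invOnePlusSubOne : ℚ_[p]⟦X⟧)} =
      Ideal.span {padicLFunction f (unitRoot W p : ℚ_[p])} := by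
  have hw : W.rootNumber ^ 2 = 1 := by
    rcases W.rootNumber_eq_one_or with h | h <;> rw [h] <;> norm_num
  exact span_singleton_subst_eq_of_mem_padicFEClass (binomialMultipliers_subset_principalUnits p)
    (isUnit_intCast_of_sq_eq_one hw) (hFE hp hord hf)

end Ordinary

/-! ### Multiplicative reduction `p ∥ N` (the exceptional-zero case included) -/

section Mult

variable {p : ℕ} [Fact p.Prime] {W : WeierstrassCurve ℚ} {N : ℕ} [NeZero N]
  {f : CuspForm (Gamma0 N) 2} {M : ℕ}

/-- The Atkin–Lehner sign of the newform at the prime-to-`p` part `M` of the level `N = pM`,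
`p ∤ M`: `w_M f = -σ f` for some `σ = ±1` (Knapp, Thm. 9.27(b), tree theorem
`IsNewform0.exists_atkinLehnerInvolution_eq_smul`). [cite: Knapp1993, Thm. 9.27(b)] -/
theorem exists_sq_eq_one_atkinLehnerInvolution_eq_smul [NeZero M] (hf : IsNewformOf W f)
    (hNM : N = p * M) (hpM : ¬ p ∣ M) :
    ∃ σ : ℤ, σ ^ 2 = 1 ∧ atkinLehnerInvolution N 2 M f = (-(σ : ℂ)) • f := by
  have hM0 : M ≠ 0 := NeZero.ne M
  have hMN : M ∣ N := ⟨p, by rw [hNM, mul_comm]⟩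
  have hcop : Nat.Coprime M (N / M) := by
    rw [hNM, mul_comm, Nat.mul_div_cancel_left p (Nat.pos_of_ne_zero hM0)]
    exact ((Nat.Prime.coprime_iff_not_dvd Fact.out).mpr hpM).symm
  obtain ⟨ε, hε, hWε⟩ := hf.1.exists_atkinLehnerInvolution_eq_smul (N := N) (k := (2 : ℤ)) hMN hcop
  obtain ⟨σ, hσ, hσε⟩ : ∃ σ : ℤ, σ ^ 2 = 1 ∧ (-(σ : ℂ)) = ε := by
    rcases hε with rfl | rfl
    · exact ⟨-1, by norm_num, by push_cast; ring⟩
    · exact ⟨1, by norm_num, by push_cast; ring⟩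
  exact ⟨σ, hσ, by rw [hσε]; exact hWε⟩

/-- **`(L(T^ι)) = (L)` in `ℚ_p⟦T⟧` at a SPLIT multiplicative prime `p ∥ N`** (the exceptional-zero
case): for `E/ℚ` split multiplicative at `p`, `f` its newform of level `N = pM`, `p ∤ M`, and
`L` THE `p`-adic `L`-function of the package `IsSplitMultPAdicLFunctionOf f p L` (MTT §I.10,
`α = a_p = 1`), the functional equation `L(T^ι) = σ (1+T)^c L` (`w_M f = -σ f`, `⟨M⟩ = γ^c`;
`IsSplitMultPAdicLFunctionOf.subst_eq_of_atkinLehner`, MTT §I.17) has unit sign and multiplier. The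
sign and the exponent are produced here, not assumed. [cite: MazurTateTeitelbaum1986Invent, §I.17]
[cite: GreenbergLNM1716, §1 (p. 68)] [cite: Knapp1993, Thm. 9.27(b)] -/
theorem _root_.Literature.NumberTheory.EllipticCurves.IsSplitMultPAdicLFunctionOf.span_singleton_subst_eq
    (hsplit : W.HasSplitMultiplicativeReductionAtPrime p) (hf : IsNewformOf W f) (hNM : N = p * M)
    (hpM : ¬ p ∣ M) {L : PowerSeries ℚ_[p]} (hL : IsSplitMultPAdicLFunctionOf f p L) :
    Ideal.span {L.subst (invOnePlusSubOne : ℚ_[p]⟦X⟧)} = Ideal.span {L} := by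
  have hM0 : M ≠ 0 := by rintro rfl; exact hpM (dvd_zero p)
  haveI : NeZero M := ⟨hM0⟩
  obtain ⟨σ, hσ, hW⟩ := exists_sq_eq_one_atkinLehnerInvolution_eq_smul hf hNM hpM
  obtain ⟨ηM, c, hc⟩ := exists_teichmuller_exponent_natCast p hpM
  have hFE := hL.subst_eq_of_atkinLehner hsplit hf hNM hpM hσ hW hc
    one_add_X_mul_invOnePlusSubOne_add_one
  exact span_singleton_subst_eq_of_subst_eq (isUnit_intCast_of_sq_eq_one hσ)
    (isUnit_binomialSeries' ℚ_[p] c) hFE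

/-- **`(L(T^ι)) = (L)` in `ℚ_p⟦T⟧` at a NON-SPLIT multiplicative prime `p ∥ N`**: the twin of
`IsSplitMultPAdicLFunctionOf.span_singleton_subst_eq` for the package
`IsMultPAdicLFunctionOf f p (-1) L` (`α = a_p = -1`), from
`IsMultPAdicLFunctionOf.subst_eq_of_atkinLehner` (MTT §I.17).
[cite: MazurTateTeitelbaum1986Invent, §I.17] [cite: GreenbergLNM1716, §1 (p. 68)]
[cite: Knapp1993, Thm. 9.27(b)] -/
theorem _root_.Literature.NumberTheory.EllipticCurves.IsMultPAdicLFunctionOf.span_singleton_subst_eq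
    (hf : IsNewformOf W f) (hmult : W.HasMultiplicativeReductionAtPrime p)
    (hns : ¬ W.HasSplitMultiplicativeReductionAtPrime p) (hNM : N = p * M) (hpM : ¬ p ∣ M)
    {L : PowerSeries ℚ_[p]} (hL : IsMultPAdicLFunctionOf f p (-1) L) :
    Ideal.span {L.subst (invOnePlusSubOne : ℚ_[p]⟦X⟧)} = Ideal.span {L} := by
  have hM0 : M ≠ 0 := by rintro rfl; exact hpM (dvd_zero p)
  haveI : NeZero M := ⟨hM0⟩
  obtain ⟨σ, hσ, hW⟩ := exists_sq_eq_one_atkinLehnerInvolution_eq_smul hf hNM hpM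
  obtain ⟨ηM, c, hc⟩ := exists_teichmuller_exponent_natCast p hpM
  have hFE := hL.subst_eq_of_atkinLehner hf hmult hns hNM hpM hσ hW hc
    one_add_X_mul_invOnePlusSubOne_add_one
  exact span_singleton_subst_eq_of_subst_eq (isUnit_intCast_of_sq_eq_one hσ)
    (isUnit_binomialSeries' ℚ_[p] c) hFE

end Mult

/-! ### In `Λ = ℤ_p⟦T⟧`: descent to integral lifts, and Sprung's pair at a supersingular `2` -/

section Lambda

variable {p : ℕ} [Fact p.Prime]

/-- **Ideal form in `Λ`, by descent.** If `L ∈ ℚ_p⟦T⟧` satisfies a functional equation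
`L(T^ι) = w (1+T)^c L` with `w = ±1` (`w² = 1`), `c ∈ ℤ_p`, and `b ∈ Λ = ℤ_p⟦T⟧` is an integral
lift of a scalar multiple, `ι_Λ b = t · L`, then `(b(T^ι)) = (b)` as ideals of `Λ` — the descended
equation `b(T^ι) = w (1+T)^c b` (`BurungaleSkinner2023.subst_invOnePlusSubOne_eq_of_iwasawaToPowerSeries_eq`, after
Burungale–Skinner 2023, Prop. 2.2) has unit sign and unit multiplier in `Λ`.
[cite: BurungaleSkinner2023, Prop. 2.2 (proof, p. 17)] [cite: GreenbergLNM1716, §1 (p. 68: "`f(T^ι)/f(T) ∈ Λ^×`")] -/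
theorem _root_.Literature.NumberTheory.EllipticCurves.IwasawaAlgebra.span_singleton_subst_eq_of_iwasawaToPowerSeries_eq
    {L : ℚ_[p]⟦X⟧} {w : ℤ} (hw : w ^ 2 = 1) {c : ℤ_[p]}
    (hFE : L.subst (invOnePlusSubOne : ℚ_[p]⟦X⟧) =
      C ((w : ℤ) : ℚ_[p]) * PowerSeries.binomialSeries ℚ_[p] c * L)
    {b : IwasawaAlgebra p} {t : ℚ_[p]} (hb : iwasawaToPowerSeries p b = C t * L) :
    Ideal.span {b.subst (invOnePlusSubOne : ℤ_[p]⟦X⟧)} = Ideal.span {b} :=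
  span_singleton_subst_eq_of_subst_eq (isUnit_intCast_of_sq_eq_one hw)
    (isUnit_binomialSeries' ℤ_[p] c)
    (BurungaleSkinner2023.subst_invOnePlusSubOne_eq_of_iwasawaToPowerSeries_eq hFE hb)

variable {W : WeierstrassCurve ℚ} [W.IsElliptic] [W.IsGloballyMinimal] {N : ℕ} [NeZero N]
  {f : CuspForm (Gamma0 N) 2}

/-- **`(b(T^ι)) = (b)` in `Λ` for every integral lift `b` of the good-ordinary `L_p(E, T)`**
(`ι_Λ b = t · L_p(E,T)`, e.g. `t = p^{μ}` clearing denominators; any level, any prime): the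
good-ordinary functional equation (`padicLFunction_mem_padicFEClass_neg_frickeEigenvalue`, MTT §I.17)
descended to `Λ`. [cite: MazurTateTeitelbaum1986Invent, §I.17]
[cite: BurungaleSkinner2023, Prop. 2.2 (proof)] [cite: GreenbergLNM1716, §1 (p. 68)] -/
theorem _root_.Literature.NumberTheory.EllipticCurves.IwasawaAlgebra.span_singleton_subst_eq_of_eq_padicLFunction
    (hord : IsOrdinaryAt W p) (hf : IsNewformOf W f) {b : IwasawaAlgebra p} {t : ℚ_[p]}
    (hb : iwasawaToPowerSeries p b = C t * padicLFunction f (unitRoot W p : ℚ_[p])) :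
    Ideal.span {b.subst (invOnePlusSubOne : ℤ_[p]⟦X⟧)} = Ideal.span {b} := by
  obtain ⟨σ, hσ, -, u, ⟨c, rfl⟩, hFE⟩ := padicLFunction_mem_padicFEClass_neg_frickeEigenvalue hord hf
  have hσ2 : σ ^ 2 = 1 := by rcases hσ with rfl | rfl <;> norm_num
  exact IwasawaAlgebra.span_singleton_subst_eq_of_iwasawaToPowerSeries_eq hσ2 hFE hb

end Lambda

section SharpFlatTwo

variable {W : WeierstrassCurve ℚ} [W.IsElliptic] [W.IsGloballyMinimal] {N : ℕ} [NeZero N]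
  {f : CuspForm (Gamma0 N) 2} {Ls Lf : IwasawaAlgebra 2}

/-- **`(L♯(T^ι)) = (L♯)` and `(L♭(T^ι)) = (L♭)` in `Λ = ℤ₂⟦T⟧`** for Sprung's pair of the newform
`f` of `W` at a good supersingular `2` with `a₂ = 0` (`IsSprungPair f 2 0 L♯ L♭`): the functional
equations `L♯(T^ι) = σ(1+T)^{c+a}L♯`, `L♭(T^ι) = σ(1+T)^{c+b}L♭`
(`exists_functionalEquation_sharp_flat_two`, Sprung 2017, Cor. 4.14) have unit sign and multipliers.
[cite: Sprung2017, Cor. 4.14] [cite: MazurTateTeitelbaum1986Invent, §I.17]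
[cite: GreenbergLNM1716, §1 (p. 68)] -/
theorem span_singleton_subst_eq_of_isSprungPair_two (hf : IsNewformOf W f)
    (hgood : W.HasGoodReductionAtPrime 2) (ha0 : W.frobeniusTrace 2 = 0)
    (h : IsSprungPair f 2 0 Ls Lf) :
    Ideal.span {Ls.subst (invOnePlusSubOne : ℤ_[2]⟦X⟧)} = Ideal.span {Ls} ∧
      Ideal.span {Lf.subst (invOnePlusSubOne : ℤ_[2]⟦X⟧)} = Ideal.span {Lf} := by
  obtain ⟨σ, hσ, -, ηN, c, a, b, -, -, -, hFE⟩ := exists_functionalEquation_sharp_flat_two hf hgood ha0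
  obtain ⟨hs, hf'⟩ := hFE Ls Lf h
  have hσ2 : σ ^ 2 = 1 := by rcases hσ with rfl | rfl <;> norm_num
  have hσu : IsUnit (σ : IwasawaAlgebra 2) := isUnit_intCast_of_sq_eq_one hσ2
  refine ⟨?_, ?_⟩
  · rw [hs]
    exact Ideal.span_singleton_mul_left_unit (hσu.mul (isUnit_binomialSeries' ℤ_[2] (c + a))) Ls
  · rw [hf']
    exact Ideal.span_singleton_mul_left_unit (hσu.mul (isUnit_binomialSeries' ℤ_[2] (c + b))) Lf

end SharpFlatTwo

end Literature.Barriers.BirchSwinnertonDyer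

end
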